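import Summits.ValiantsHypothesis.ValiantsHypothesis.Theorems.DefinabilityGapZeroPatternPermanent
import Summits.ValiantsHypothesis.ValiantsHypothesis.Theorems.DefinabilityGapPrimeRigidity
import HarnessLib

/-!
# DefinabilityGap — LABEL SUPPORT, stage E3: S-rigidity of width-2 chains (`chainVal_eq_zero_of_support`)

Route `route-ValiantsHypothesis-DefinabilityGap` (DRAFT), read-once leaf F4 / W10 (aside `KIPlantedHittingRO`,
stmt-ValiantsHypothesis-23704), leaf `ZperHits₂(m)` = hypothesis `hZ` of
`DefinabilityGapZperTransfer.chainVal_eq_zero_of_bind₁_kiPer` (decomp-valiant bus, OFFER O-L5-LS l.1198 /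
CALL l.1212; last file of the series E1 / E2 / E3).

**THEOREM** (`chainVal_eq_zero_of_support`). `K` a field, `c < m`, `S` a set of at most `m - 2` cells, `l` a
width-2 chain of univariate-image links `M_j(ℓ_j)` (`M_j ∈ K[t]^{2×2}`, `|vars ℓ_j| ≤ c`) such that every link
is EITHER a unit link (`IsUnit M_j.det`) OR has its label supported in `S` (`vars ℓ_j ⊆ S`). Then
`per_m ∣ uᵀ M_1(ℓ_1) ⋯ M_N(ℓ_N) v ⇒ uᵀ M_1(ℓ_1) ⋯ M_N(ℓ_N) v = 0` — any length. Equivalently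
(`exists_nonunit_escaping`): in a width-2 VOID (a non-zero chain value divisible by `per_m`) the labels of the
NON-UNIT links are not contained in any `m - 2` cells — they touch at least `m - 1` cells, so there are at least
`⌈(m-1)/c⌉` non-unit links. S2 (`DefinabilityGapUnitRigidity`) was the case `S = ∅`.

Proof. SPECIALISE the cells of `S` to constants: for an injective ring map `ι : K[Y] → K'` into a field (we use
`K' = K(Y) = Frac K[Y]`), `Φ_S : K[Y] → K'[Y]`, `y_s ↦ ι(y_s)` for `s ∈ S`, `y_p ↦ Y_p` otherwise (`spec`;
injective, `spec_injective`, by the left inverse `Y_p ↦ ι(y_p)`). Under `Φ_S` a unit link stays a unit link with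
a `c`-local argument, an `S`-labelled link becomes a CONSTANT matrix over `K'` (possibly singular), and
`Φ_S(per_m)` is a polynomial whose TOP FORM is the zero-pattern permanent `Q_S`
(`topForm_spec_perPoly`: the permutations meeting `S` contribute terms of degree `< m`). `Q_S` is prime for
`|S| ≤ m - 2` (E1 `zpPer_prime`, Brualdi–Ryser) and prime to every non-zero `c`-local top form for `c < m`
(`not_zpPer_dvd_topForm`, every monomial of a multiple of `Q_S` meets all `m` columns), so E2's PRIME RIGIDITY
FOR MIXED CHAINS (`DefinabilityGapPrimeRigidity.chainVal_eq_zero_of_prime_of_eq_mul`) gives `Φ_S(value) = 0`.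
The headline is DERIVED from the prime-hypothesis form `chainVal_eq_zero_of_support_of_prime` (any injective
`ι : K[Y] →+* K'` into a field, hypothesis `Prime (Q_S)` over `K'` only), which also covers larger `S` whenever
`Q_S` happens to be prime.

NOT COVERED (sharp side): `|S| = m - 1` may make `Q_S` reducible (`m = 3`, `S` = two cells of one row) and then
voids with non-unit labels inside `S` are not excluded by this method; the leaf `ZperHits₂(m)` itself stays OPEN.
HONEST GRADE (critic, l.1212): KNOWN ingredients (Brualdi–Ryser 1991 Thm 9.2.4-per; Allender–Wang 2016 / BIZ18
Def 5.5–Thm 5.6; Cohn 1966 as in S1a–S2); NEW COMBINATION on this leaf = prime-generic walk + rank-one cuts +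
localisation `K(Y)` + zero-pattern permanent as the prime; kernel-new; closes NO item; 0 S-currency; rung 0;
VP ≠ VNP untouched. No facts, no Prop-valued definitions, no placeholders; data definitions `specVar`, `spec`
(the constants map `K → K'` is `ι.comp C`, the field `K(Y)` is Mathlib's `FractionRing`).
-/

set_option linter.dupNamespace false

open MvPolynomial Finset
open scoped Pointwise
open Literature.Computability.AlgebraicComplexity
open Summit.ValiantsHypothesis.ValiantsHypothesis.Theorems.DefinabilityGapUnitRigidityForms
open Summit.ValiantsHypothesis.ValiantsHypothesis.Theorems.DefinabilityGapZperTransfer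
open Summit.ValiantsHypothesis.ValiantsHypothesis.Theorems.DefinabilityGapZeroPatternPermanent
open Summit.ValiantsHypothesis.ValiantsHypothesis.Theorems.DefinabilityGapPrimeRigidity

namespace Summit.ValiantsHypothesis.ValiantsHypothesis.Theorems.DefinabilityGapLabelSupport

noncomputable section

variable {K : Type*} [Field K] {m : ℕ}

/-! ## 1. KEY for the zero-pattern permanent: `locSpan c ∩ (Q_S) = 0` for `c < m` (any field, any `S`) -/

section Key

variable {F : Type*} [Field F] {c : ℕ}

/-- KEY: for `c < m` the `c`-local span meets the ideal `(Q_S)` only in `0` — every monomial of `Q_S · H` is a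
permutation monomial times a monomial of `H`, so it meets all `m` columns. [this file] -/
theorem eq_zero_of_mem_locSpan_of_zpPer_dvd (hcm : c < m) (S : Finset (Fin m × Fin m))
    {f : MvPolynomial (Fin m × Fin m) F} (hf : f ∈ locSpan F (Fin m × Fin m) c) (h : zpPer F S ∣ f) :
    f = 0 := by
  classical
  obtain ⟨H, rfl⟩ := h
  by_contra hne
  obtain ⟨d, hd⟩ := support_nonempty.2 hne
  have hc := (mem_locSpan.1 hf) d hd
  obtain ⟨a, ha, b, -, rfl⟩ := Finset.mem_add.1 (support_mul _ _ hd)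
  obtain ⟨ρ, -, rfl⟩ := exists_perm_of_coeff_zpPer_ne_zero F (mem_support_iff.1 ha)
  have hm : m ≤ (permMonomial ρ + b).support.card := by
    calc m = (univ.image fun i : Fin m => (ρ i, i)).card := by
          rw [card_image_of_injective _ fun i j hij => (Prod.mk.inj hij).2, card_univ, Fintype.card_fin]
      _ ≤ (permMonomial ρ + b).support.card := card_le_card fun v hv => by
          obtain ⟨i, -, rfl⟩ := mem_image.1 hv
          have h1 : permMonomial ρ (ρ i, i) = 1 := by rw [permMonomial_apply, if_pos rfl]
          show (ρ i, i) ∈ (permMonomial ρ + b).support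
          rw [Finsupp.mem_support_iff, Finsupp.add_apply, h1]
          omega
  omega

/-- KEY on top forms: `Q_S` is prime to the top form of every non-zero `c`-local polynomial (`c < m`).
[this file] -/
theorem not_zpPer_dvd_topForm (hcm : c < m) (S : Finset (Fin m × Fin m))
    {f : MvPolynomial (Fin m × Fin m) F} (hf : f ∈ locSpan F (Fin m × Fin m) c) (h0 : f ≠ 0) :
    ¬ zpPer F S ∣ topForm f :=
  fun hd => topForm_ne_zero h0 (eq_zero_of_mem_locSpan_of_zpPer_dvd hcm S (topForm_mem_locSpan hf) hd)

end Key

/-! ## 2. The specialisation `Φ_S : K[Y] → K(Y)[Y]` -/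

section Spec

/- Throughout, `ι : K[Y] →+* K'` is a ring map into a field (injective where it matters); the derived headline
uses `K' = FractionRing K[Y]` and `ι = algebraMap`. -/
variable {K' : Type*} [Field K'] (ι : MvPolynomial (Fin m × Fin m) K →+* K')

/-- `Φ_S` on variables: a cell of `S` becomes the constant `ι(y_s) ∈ K'`, any other cell stays a variable.
[this file] -/
def specVar (S : Finset (Fin m × Fin m)) (p : Fin m × Fin m) : MvPolynomial (Fin m × Fin m) K' :=
  if p ∈ S then C (ι (X p)) else X p

/-- THE SPECIALISATION `Φ_S : K[Y] →+* K'[Y]` (constants through `ι ∘ C`). [this file] -/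
def spec (S : Finset (Fin m × Fin m)) : MvPolynomial (Fin m × Fin m) K →+* MvPolynomial (Fin m × Fin m) K' :=
  eval₂Hom (C.comp (ι.comp C)) (specVar ι S)

/-- `Φ_S` on constants. [this file] -/
theorem spec_C (S : Finset (Fin m × Fin m)) (a : K) : spec ι S (C a) = C ((ι.comp C) a) :=
  eval₂Hom_C _ _ _

/-- `Φ_S` on variables. [this file] -/
theorem spec_X (S : Finset (Fin m × Fin m)) (p : Fin m × Fin m) : spec ι S (X p) = specVar ι S p :=
  eval₂Hom_X' _ _ _

/-- The left inverse `Y_p ↦ ι(y_p)` of `Φ_S` (up to `ι`). [this file] -/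
theorem eval_comp_spec (S : Finset (Fin m × Fin m)) : (eval fun p => ι (X p)).comp (spec ι S) = ι := by
  refine ringHom_ext (fun a => ?_) (fun p => ?_)
  · rw [RingHom.comp_apply, spec_C, eval_C, RingHom.comp_apply]
  · rw [RingHom.comp_apply, spec_X, specVar]
    split_ifs with hp
    · rw [eval_C]
    · rw [eval_X]

/-- `Φ_S` IS INJECTIVE as soon as `ι` is. [this file] -/
theorem spec_injective (hι : Function.Injective ι) (S : Finset (Fin m × Fin m)) :
    Function.Injective (spec ι S) := by
  intro a b hab
  have h := congrArg (eval fun p => ι (X p)) hab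
  rw [← RingHom.comp_apply, ← RingHom.comp_apply, eval_comp_spec] at h
  exact hι h

/-- `Φ_S = bind₁ (specVar) ∘ map (ι ∘ C)`. [this file] -/
theorem spec_eq_bind₁_map (S : Finset (Fin m × Fin m)) (f : MvPolynomial (Fin m × Fin m) K) :
    spec ι S f = bind₁ (specVar ι S) (map (ι.comp C) f) := by
  have h : spec ι S = (bind₁ (specVar ι S)).toRingHom.comp (map (ι.comp C)) :=
    ringHom_ext (fun a => by simp [spec]) (fun s => by simp [spec])
  rw [h]
  rfl

/-- `Φ_S` reads only the off-`S` variables of its argument. [this file] -/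
theorem vars_spec_subset (S : Finset (Fin m × Fin m)) (f : MvPolynomial (Fin m × Fin m) K) :
    (spec ι S f).vars ⊆ f.vars.filter (· ∉ S) := by
  classical
  rw [spec_eq_bind₁_map]
  refine (vars_bind₁ _ _).trans fun p hp => ?_
  obtain ⟨q, hq, hpq⟩ := Finset.mem_biUnion.1 hp
  have hq' : q ∈ f.vars := vars_map _ _ hq
  unfold specVar at hpq
  split_ifs at hpq with hqS
  · rw [vars_C] at hpq
    exact absurd hpq (Finset.notMem_empty _)
  · rw [vars_X, Finset.mem_singleton] at hpq
    subst hpq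
    exact Finset.mem_filter.2 ⟨hq', hqS⟩

/-- An `S`-supported polynomial becomes a constant. [this file] -/
theorem spec_eq_C (S : Finset (Fin m × Fin m)) {f : MvPolynomial (Fin m × Fin m) K} (hf : f.vars ⊆ S) :
    spec ι S f = C (coeff 0 (spec ι S f)) := by
  refine eq_C_of_vars_eq_empty (Finset.eq_empty_of_forall_notMem fun p hp => ?_)
  have h := Finset.mem_filter.1 (vars_spec_subset ι S f hp)
  exact h.2 (hf h.1)

/-! ## 3. The top form of `Φ_S(per_m)` is `Q_S` -/

/-- `Φ_S(per_m) = ∑_ρ ∏_i Φ_S(y_(ρ i, i))`. [this file] -/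
theorem spec_perPoly (S : Finset (Fin m × Fin m)) :
    spec ι S (perPoly (Fin m) K) = ∑ ρ : Equiv.Perm (Fin m), ∏ i, specVar ι S (ρ i, i) := by
  unfold perPoly Matrix.permanent
  rw [map_sum]
  refine Finset.sum_congr rfl fun ρ _ => ?_
  rw [map_prod]
  refine Finset.prod_congr rfl fun i _ => ?_
  rw [Matrix.mvPolynomialX_apply, spec_X]

/-- `Φ_S(y_p)` is homogeneous, of degree `0` on `S` and `1` off `S`. [this file] -/
theorem specVar_isHomogeneous (S : Finset (Fin m × Fin m)) (p : Fin m × Fin m) :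
    (specVar ι S p).IsHomogeneous (if p ∉ S then 1 else 0) := by
  unfold specVar
  by_cases hp : p ∈ S
  · rw [if_pos hp, if_neg (not_not.2 hp)]
    exact isHomogeneous_C _ _
  · rw [if_neg hp, if_pos hp]
    exact isHomogeneous_X _ _

/-- The `ρ`-term of `Φ_S(per_m)` is homogeneous of degree `#{i : (ρ i, i) ∉ S}`. [this file] -/
theorem prod_specVar_isHomogeneous (S : Finset (Fin m × Fin m)) (ρ : Equiv.Perm (Fin m)) :
    (∏ i, specVar ι S (ρ i, i)).IsHomogeneous (∑ i : Fin m, if (ρ i, i) ∉ S then 1 else 0) :=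
  IsHomogeneous.prod univ (fun i => specVar ι S (ρ i, i)) (fun i => if (ρ i, i) ∉ S then 1 else 0)
    fun i _ => specVar_isHomogeneous ι S (ρ i, i)

/-- … and that degree is `m` exactly for the permutations avoiding `S`. [this file] -/
theorem sum_ite_eq_iff (S : Finset (Fin m × Fin m)) (ρ : Equiv.Perm (Fin m)) :
    (∑ i : Fin m, if (ρ i, i) ∉ S then 1 else 0) = m ↔ ρ ∈ avoid S := by
  have hu : (univ : Finset (Fin m)).card = m := by rw [Finset.card_univ, Fintype.card_fin]
  simp only [Finset.sum_boole, Nat.cast_id, mem_avoid]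
  constructor
  · intro h i
    exact (Finset.card_filter_eq_iff.1 (h.trans hu.symm)) i (mem_univ i)
  · intro h
    rw [Finset.filter_true_of_mem fun i _ => h i, hu]

/-- The degree-`m` component of the `ρ`-term: the permutation monomial if `ρ` avoids `S`, else `0`. [this file] -/
theorem homogeneousComponent_prod_specVar (S : Finset (Fin m × Fin m)) (ρ : Equiv.Perm (Fin m)) :
    homogeneousComponent m (∏ i, specVar ι S (ρ i, i)) =
      if ρ ∈ avoid S then ∏ i, (X (ρ i, i) : MvPolynomial (Fin m × Fin m) K') else 0 := by
  rw [homogeneousComponent_of_mem ((mem_homogeneousSubmodule _ _).2 (prod_specVar_isHomogeneous ι S ρ))]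
  by_cases hρ : ρ ∈ avoid S
  · rw [if_pos ((sum_ite_eq_iff S ρ).2 hρ).symm, if_pos hρ]
    exact Finset.prod_congr rfl fun i _ => by rw [specVar, if_neg (mem_avoid.1 hρ i)]
  · rw [if_neg (fun h => hρ ((sum_ite_eq_iff S ρ).1 h.symm)), if_neg hρ]

/-- The degree-`m` component of `Φ_S(per_m)` is `Q_S`. [this file] -/
theorem homogeneousComponent_spec_perPoly (S : Finset (Fin m × Fin m)) :
    homogeneousComponent m (spec ι S (perPoly (Fin m) K)) = zpPer K' S := by
  unfold zpPer
  rw [spec_perPoly, map_sum, Finset.sum_congr rfl fun ρ _ => homogeneousComponent_prod_specVar ι S ρ,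
    Finset.sum_ite_mem_eq]

/-- `deg Φ_S(per_m) = m` as soon as `Q_S ≠ 0`. [this file] -/
theorem totalDegree_spec_perPoly (S : Finset (Fin m × Fin m)) (h0 : zpPer K' S ≠ 0) :
    (spec ι S (perPoly (Fin m) K)).totalDegree = m := by
  refine le_antisymm ?_ ?_
  · rw [spec_perPoly]
    refine (totalDegree_finsetSum _ _).trans (Finset.sup_le fun ρ _ => ?_)
    refine (prod_specVar_isHomogeneous ι S ρ).totalDegree_le.trans ?_
    simp only [Finset.sum_boole, Nat.cast_id]
    exact (Finset.card_filter_le _ _).trans (by rw [Finset.card_univ, Fintype.card_fin])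
  · by_contra hlt
    push Not at hlt
    exact h0 (by rw [← homogeneousComponent_spec_perPoly ι S, homogeneousComponent_eq_zero _ _ hlt])

/-- **The top form of `Φ_S(per_m)` is the zero-pattern permanent `Q_S`** (whenever `Q_S ≠ 0`). [this file] -/
theorem topForm_spec_perPoly (S : Finset (Fin m × Fin m)) (h0 : zpPer K' S ≠ 0) :
    topForm (spec ι S (perPoly (Fin m) K)) = zpPer K' S := by
  unfold topForm
  rw [totalDegree_spec_perPoly ι S h0, homogeneousComponent_spec_perPoly]

/-! ## 4. Links under `Φ_S` -/

/-- Unit links stay unit links under a change of constants. [this file] -/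
theorem isUnit_det_map_map {F F' : Type*} [CommRing F] [CommRing F'] (g : F →+* F')
    {M : Matrix (Fin 2) (Fin 2) (Polynomial F)} (h : IsUnit M.det) :
    IsUnit (M.map (Polynomial.map g)).det := by
  rw [show M.map (Polynomial.map g) = (Polynomial.mapRingHom g).mapMatrix M from rfl, ← RingHom.map_det]
  exact h.map _

/-- A univariate-image link with a CONSTANT argument is a constant matrix. [this file] -/
theorem map_eval_eq_ulink_C {F' : Type*} [CommSemiring F'] {τ : Type*}
    (M : Matrix (Fin 2) (Fin 2) (Polynomial F')) (a : F') :
    (M.map (Polynomial.eval a)).map C = ulink (M, (C a : MvPolynomial τ F')) := by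
  ext i k
  simp only [ulink, Matrix.map_apply]
  rw [← MvPolynomial.algebraMap_eq, Polynomial.aeval_algebraMap_apply_eq_algebraMap_eval]

/-- Under `Φ_S` every link of the chain becomes an admissible MIXED link over `K'` in the sense of
`DefinabilityGapPrimeRigidity.chainVal_eq_zero_of_prime`: a unit link with a `c`-local argument (if it was a unit
link), or a constant matrix (if its label lies in `S`). [this file] -/
theorem spec_ulink_mem (S : Finset (Fin m × Fin m)) {c : ℕ}
    {e : Matrix (Fin 2) (Fin 2) (Polynomial K) × MvPolynomial (Fin m × Fin m) K}
    (hloc : ∃ T : Finset (Fin m × Fin m), T.card ≤ c ∧ e.2.vars ⊆ T) (hsup : IsUnit e.1.det ∨ e.2.vars ⊆ S) :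
    (∃ e' : Matrix (Fin 2) (Fin 2) (Polynomial K') × MvPolynomial (Fin m × Fin m) K',
        IsUnit e'.1.det ∧ (∃ T : Finset (Fin m × Fin m), T.card ≤ c ∧ e'.2.vars ⊆ T) ∧
          ulink e' = (ulink e).map (spec ι S)) ∨
      ∃ N₀ : Matrix (Fin 2) (Fin 2) K', N₀.map C = (ulink e).map (spec ι S) := by
  obtain ⟨M, x⟩ := e
  rcases hsup with hu | hxS
  · -- a unit link stays a unit link with a `c`-local argument
    refine Or.inl ⟨(M.map (Polynomial.map (ι.comp C)), spec ι S x), isUnit_det_map_map _ hu, ?_, ?_⟩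
    · obtain ⟨T, hT, hxT⟩ := hloc
      exact ⟨T, hT, ((vars_spec_subset ι S x).trans (Finset.filter_subset _ _)).trans hxT⟩
    · exact (map_ulink (spec ι S) (ι.comp C) (spec_C ι S) M x).symm
  · -- an `S`-labelled link becomes a constant matrix
    obtain ⟨a, ha⟩ : ∃ a, spec ι S x = C a := ⟨_, spec_eq_C ι S hxS⟩
    refine Or.inr ⟨(M.map (Polynomial.map (ι.comp C))).map (Polynomial.eval a), ?_⟩
    rw [map_ulink (spec ι S) (ι.comp C) (spec_C ι S) M x, ha]
    exact map_eval_eq_ulink_C _ _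

/-! ## 5. S-rigidity -/

section Main

variable {c : ℕ}

/-- **S-RIGIDITY, prime-hypothesis form.** `c < m`; `ι : K[Y] →+* K'` injective into a field; `S` any cell
set whose zero-pattern permanent `Q_S` is prime over `K'`; every link `c`-local and EITHER unit OR
`S`-labelled: `per_m ∣ uᵀ L v ⇒ uᵀ L v = 0`. [this file] -/
theorem chainVal_eq_zero_of_support_of_prime (hcm : c < m) (hι : Function.Injective ι)
    {S : Finset (Fin m × Fin m)} (hQ : Prime (zpPer K' S))
    (l : List (Matrix (Fin 2) (Fin 2) (Polynomial K) × MvPolynomial (Fin m × Fin m) K))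
    (hloc : ∀ e ∈ l, ∃ T : Finset (Fin m × Fin m), T.card ≤ c ∧ e.2.vars ⊆ T)
    (hsup : ∀ e ∈ l, IsUnit e.1.det ∨ e.2.vars ⊆ S) (u v : Fin 2 → K)
    (H : MvPolynomial (Fin m × Fin m) K) (h : chainVal (l.map ulink) u v = perPoly (Fin m) K * H) :
    chainVal (l.map ulink) u v = 0 := by
  have hspec : spec ι S (chainVal (l.map ulink) u v) = chainVal ((l.map ulink).map fun N => N.map (spec ι S))
      (fun i => (ι.comp C) (u i)) (fun k => (ι.comp C) (v k)) :=
    map_chainVal (spec ι S) (ι.comp C) (spec_C ι S) _ u v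
  have key : chainVal ((l.map ulink).map fun N => N.map (spec ι S)) (fun i => (ι.comp C) (u i))
      (fun k => (ι.comp C) (v k)) = 0 := by
    refine chainVal_eq_zero_of_prime_of_eq_mul hQ (fun f hf h0 => not_zpPer_dvd_topForm hcm S hf h0)
      (P := spec ι S (perPoly (Fin m) K)) (dvd_of_eq (topForm_spec_perPoly ι S hQ.ne_zero).symm) _ ?_ _ _
      (spec ι S H) (by rw [← hspec, h, map_mul])
    intro N hN
    obtain ⟨N', hN', rfl⟩ := List.mem_map.1 hN
    obtain ⟨e, he, rfl⟩ := List.mem_map.1 hN'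
    exact spec_ulink_mem ι S (hloc e he) (hsup e he)
  exact spec_injective ι hι S (by rw [hspec, key, map_zero])

/-- **S-RIGIDITY / LABEL-SUPPORT BOUND.** `K` any field, `c < m`, `|S| ≤ m - 2`; a width-2 chain of
univariate-image links `M_j(ℓ_j)` with `|vars ℓ_j| ≤ c`, each link a unit link OR with `vars ℓ_j ⊆ S`:
`per_m ∣ uᵀ M_1(ℓ_1) ⋯ M_N(ℓ_N) v ⇒ uᵀ M_1(ℓ_1) ⋯ M_N(ℓ_N) v = 0` — any length (`ι` = the embedding of
`K[Y]` in its fraction field `K(Y)`, `Q_S` prime there by E1 `zpPer_prime`; `S = ∅`: S2's unit rigidity).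
[this file] -/
theorem chainVal_eq_zero_of_support (hcm : c < m) (S : Finset (Fin m × Fin m)) (hS : S.card + 2 ≤ m)
    (l : List (Matrix (Fin 2) (Fin 2) (Polynomial K) × MvPolynomial (Fin m × Fin m) K))
    (hloc : ∀ e ∈ l, ∃ T : Finset (Fin m × Fin m), T.card ≤ c ∧ e.2.vars ⊆ T)
    (hsup : ∀ e ∈ l, IsUnit e.1.det ∨ e.2.vars ⊆ S) (u v : Fin 2 → K)
    (H : MvPolynomial (Fin m × Fin m) K) (h : chainVal (l.map ulink) u v = perPoly (Fin m) K * H) :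
    chainVal (l.map ulink) u v = 0 :=
  chainVal_eq_zero_of_support_of_prime (K' := FractionRing (MvPolynomial (Fin m × Fin m) K))
    (algebraMap _ _) hcm (IsFractionRing.injective _ _) (zpPer_prime hS) l hloc hsup u v H h

/-- **COROLLARY (placement of the non-unit links of a void).** In a width-2 VOID — a non-zero chain value
divisible by `per_m`, all links `c`-local, `c < m` — the labels of the NON-UNIT links escape every set of
`m - 2` cells: for each such `S` some non-unit link has a variable outside `S`. [this file] -/
theorem exists_nonunit_escaping (hcm : c < m) (S : Finset (Fin m × Fin m)) (hS : S.card + 2 ≤ m)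
    (l : List (Matrix (Fin 2) (Fin 2) (Polynomial K) × MvPolynomial (Fin m × Fin m) K))
    (hloc : ∀ e ∈ l, ∃ T : Finset (Fin m × Fin m), T.card ≤ c ∧ e.2.vars ⊆ T) (u v : Fin 2 → K)
    (H : MvPolynomial (Fin m × Fin m) K) (h : chainVal (l.map ulink) u v = perPoly (Fin m) K * H)
    (hne : chainVal (l.map ulink) u v ≠ 0) : ∃ e ∈ l, ¬ IsUnit e.1.det ∧ ¬ e.2.vars ⊆ S := by
  by_contra hno
  push Not at hno
  exact hne (chainVal_eq_zero_of_support hcm S hS l hloc (fun e he => or_iff_not_imp_left.2 (hno e he))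
    u v H h)

/-- LEAF-SHAPED INSTANCE (`c = 2`, `m ≥ 3`): the leaf's hypothesis `hZ` restricted to chains whose non-unit
links are all labelled inside one cell set `T` with `|T| ≤ m - 2`. [this file] -/
theorem zperHits_of_nonunit_labels_subset (hm : 3 ≤ m) (F : Type*) [Field F]
    (T : Finset (Fin m × Fin m)) (hT : T.card + 2 ≤ m)
    (l : List (Matrix (Fin 2) (Fin 2) (Polynomial F) × MvPolynomial (Fin m × Fin m) F))
    (hl : ∀ e ∈ l, ∃ S : Finset (Fin m × Fin m), S.card ≤ 2 ∧ e.2.vars ⊆ S)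
    (hone : ∀ e ∈ l, IsUnit e.1.det ∨ e.2.vars ⊆ T) (u v : Fin 2 → F)
    (H : MvPolynomial (Fin m × Fin m) F) (h : chainVal (l.map ulink) u v = perPoly (Fin m) F * H) :
    chainVal (l.map ulink) u v = 0 :=
  chainVal_eq_zero_of_support (c := 2) (by omega) T hT l hl hone u v H h

/-- LEAF-SHAPED INSTANCE (`c = 2`, `m ≥ 4`): no void whose non-unit links are all labelled inside ONE
`2`-set of cells — in particular a void has at least two non-unit links whose labels do not fit in a common
`2`-set of cells. [this file] -/
theorem zperHits_of_nonunit_labels_pair (hm : 4 ≤ m) (F : Type*) [Field F]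
    (T : Finset (Fin m × Fin m)) (hT : T.card ≤ 2)
    (l : List (Matrix (Fin 2) (Fin 2) (Polynomial F) × MvPolynomial (Fin m × Fin m) F))
    (hl : ∀ e ∈ l, ∃ S : Finset (Fin m × Fin m), S.card ≤ 2 ∧ e.2.vars ⊆ S)
    (hone : ∀ e ∈ l, IsUnit e.1.det ∨ e.2.vars ⊆ T) (u v : Fin 2 → F)
    (H : MvPolynomial (Fin m × Fin m) F) (h : chainVal (l.map ulink) u v = perPoly (Fin m) F * H) :
    chainVal (l.map ulink) u v = 0 :=
  chainVal_eq_zero_of_support (c := 2) (by omega) T (by omega) l hl hone u v H h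

end Main

end Spec

end

end Summit.ValiantsHypothesis.ValiantsHypothesis.Theorems.DefinabilityGapLabelSupport
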